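import Literature.NumberTheory.NumberFields.CMFieldCapitulationKernelOddDegree
import Literature.NumberTheory.NumberFields.CMFieldNonPrimaryOfUnramified
import HarnessLib

/-!
# `κ_F Q_F = 2` for a CM field `F ∌ √−1` with `F/F⁺` unramified at the finite primes, and
# `κ_F Q_F = 2 ⟹ F/F⁺` unramified at the odd primes (Okazaki, *Acta Arith.* 92 (2000), §3 Lemma 14)

Topic `NumberTheory/NumberFields`; namespace `Literature.NumberTheory.NumberFields`.  Theorem-only file
(no definition, no named fact, no `sorry`), unconditional.  It is the junction of

* `CMFieldCapitulationKernelOddDegree.lean` §7 — Lemma 14's characterisations **`κ_F Q_F = 2 ⟺ F` is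
  non-primary** (the converse «unless `F = F⁺(√−1)`»), `Q_F = 2 ⟹ κ_F = 1` being Washington's Thm. 10.3
  (`CMFieldCapitulationKernel.lean`); that file's honest column records that the RAMIFICATION clauses of
  Lemma 14 were not formalised there;
* `CMFieldNonPrimaryOfUnramified.lean` — exactly those clauses: **`F/F⁺` unramified at the finite primes
  ⟹ `F` non-primary**, and **`F` non-primary ⟹ `F/F⁺` unramified at every finite prime not above `2`**.

> Okazaki, §3, Definition 13. "A CM-field `F` is said to be *non-primary* if `F = F⁺(√−δ)` for some
> `δ ∈ F⁺` which generates a square ideal of `F⁺`; it is said to be primary otherwise."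
> **Lemma 14.** "Let `F` be a CM-field.  Then `κ_F Q_F | 2`.  When `κ_F Q_F = 2`, the CM-field `F` is
> non-primary.  When `Q_F = 2`, the CM-field `F` is of unit radical form.  Conversely, a non-primary
> CM-field `F` satisfies `κ_F Q_F = 2` unless `F = F⁺(√−1)`. […] Moreover, `F` is non-primary if `F/F⁺`
> is unramified at the finite primes.  On the other hand, `F/F⁺` is unramified at all odd primes if `F`
> is non-primary.  *Proof.* This is well known (cf. [16] or [27, Theorems 4.12 and 10.3])."

Here `κ_F = #ker(C_{F⁺} → C_F)` is `Nat.card (classGroupExtend F⁺ F).ker` and `Q_F = [E_F : W_F E_{F⁺}]`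
is Mathlib's `indexRealUnits F`; «unless `F = F⁺(√−1)`» is the hypothesis that `−1` is not a square in
`F`; «unramified at the finite prime `v` of `F⁺`» is `Algebra.IsUnramifiedIn (𝓞 F) v` (equivalently
`e(v, F/F⁺) = 1`, `IsCMField.forall_ramificationIdxIn_eq_one_iff_forall_isUnramifiedIn`); «odd prime»
is a finite prime `v` of `F⁺` with `2 ∉ v`.

## Main results (`K : Type` a CM number field, `K⁺ = maximalRealSubfield K`)

* **`IsCMField.card_ker_mul_indexRealUnits_eq_two_of_forall_isUnramifiedIn`** (and
  `…_of_forall_ramificationIdxIn_eq_one`) — **`K/K⁺` unramified at every finite prime and `√−1 ∉ K`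
  ⟹ `κ_K Q_K = 2`**; `IsCMField.card_ker_eq_two_or_indexRealUnits_eq_two_of_forall_isUnramifiedIn` —
  hence `(κ_K, Q_K) = (2, 1)` or `(1, 2)`: either an ideal class of `K⁺` capitulates in `K`, or `K` has a
  unit `ε` with `ε̄ = −ε` (unit radical form), never both.
* `IsCMField.exists_not_isUnramifiedIn_of_card_ker_mul_indexRealUnits_eq_one` — contrapositive:
  `κ_K Q_K = 1` and `√−1 ∉ K` ⟹ some finite prime of `K⁺` ramifies in `K`.
* **`IsCMField.isUnramifiedIn_of_card_ker_mul_indexRealUnits_eq_two`** — **`κ_K Q_K = 2 ⟹ K/K⁺` is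
  unramified at every finite prime `v ∤ 2`** (no hypothesis on `√−1`); the special cases
  `IsCMField.isUnramifiedIn_of_card_ker_classGroupExtend_eq_two` (`κ_K = 2`) and
  `IsCMField.isUnramifiedIn_of_indexRealUnits_eq_two` (`Q_K = 2`).
* `IsCMField.card_ker_mul_indexRealUnits_eq_one_of_not_isUnramifiedIn` — conversely, **if `K/K⁺` ramifies
  at some finite prime `v ∤ 2` then `κ_K Q_K = 1`**, i.e. `κ_K = 1` (`C_{K⁺} → C_K` injective,
  `IsCMField.classGroupExtend_injective_of_not_isUnramifiedIn`) and `Q_K = 1`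
  (`IsCMField.indexRealUnits_eq_one_of_not_isUnramifiedIn`).

Honest column: every statement here is a two-line assembly of the cited theorems of the two imported files;
nothing is claimed at the dyadic primes in the direction «non-primary ⟹ unramified» (Okazaki: «at all odd
primes»; his Example B2, `F = ℚ(√40, √−4)` with `κ_F = 2` and `F/F⁺` ramified above `2`, shows the
restriction is necessary).

## References

* R. Okazaki, *Inclusion of CM-fields and divisibility of relative class numbers*, Acta Arith. 92 (2000)
  319–338, §3 Def. 13, Lemma 14, Examples B1–B4 (held `paper:doi-10-4064-aa-92-4-319-338`, pp. 8–9).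
  [Okazaki2000]
* L. C. Washington, *Introduction to Cyclotomic Fields*, 2nd ed., GTM 83 (1997), Thms. 4.12, 10.3.
  [Washington1997]
-/

noncomputable section

open NumberField NumberField.IsCMField NumberField.Units IsDedekindDomain
open scoped nonZeroDivisors

namespace Literature.NumberTheory.NumberFields

variable (K : Type) [Field K] [NumberField K] [IsCMField K]

/-! ### §1. Unramified at the finite primes ⟹ `κ_K Q_K = 2` -/

/-- **Okazaki's Lemma 14, assembled: if `e(v, K/K⁺) = 1` for every finite prime `v` of `K⁺` and `−1` is not
a square in `K`, then `κ_K Q_K = 2`** — `K` is non-primary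
(`IsCMField.nonPrimary_of_forall_ramificationIdxIn_eq_one`), and a non-primary CM field `∌ √−1` has
`κ Q = 2` (`IsCMField.card_ker_mul_indexRealUnits_eq_two_of_sq_eq_neg`). [cite: Okazaki2000, §3 Lemma 14] -/
theorem IsCMField.card_ker_mul_indexRealUnits_eq_two_of_forall_ramificationIdxIn_eq_one
    (hi : ∀ x : K, x ^ 2 ≠ -1)
    (h1 : ∀ v : HeightOneSpectrum (𝓞 (maximalRealSubfield K)), v.asIdeal.ramificationIdxIn (𝓞 K) = 1) :
    Nat.card (classGroupExtend (maximalRealSubfield K) K).ker * indexRealUnits K = 2 := by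
  obtain ⟨α, δ, 𝔞, hα0, hconj, hδ, h𝔞⟩ := IsCMField.nonPrimary_of_forall_ramificationIdxIn_eq_one K h1
  exact IsCMField.card_ker_mul_indexRealUnits_eq_two_of_sq_eq_neg K hα0 hconj hδ h𝔞 hi

/-- **Okazaki's Lemma 14, assembled: if `K/K⁺` is unramified at every finite prime of `K⁺` and `−1` is not a
square in `K`, then `κ_K Q_K = 2`.** [cite: Okazaki2000, §3 Lemma 14] -/
theorem IsCMField.card_ker_mul_indexRealUnits_eq_two_of_forall_isUnramifiedIn (hi : ∀ x : K, x ^ 2 ≠ -1)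
    (hunr : ∀ v : HeightOneSpectrum (𝓞 (maximalRealSubfield K)), Algebra.IsUnramifiedIn (𝓞 K) v.asIdeal) :
    Nat.card (classGroupExtend (maximalRealSubfield K) K).ker * indexRealUnits K = 2 := by
  obtain ⟨α, δ, 𝔞, hα0, hconj, hδ, h𝔞⟩ := IsCMField.nonPrimary_of_isUnramifiedIn K hunr
  exact IsCMField.card_ker_mul_indexRealUnits_eq_two_of_sq_eq_neg K hα0 hconj hδ h𝔞 hi

/-- `Q_K = 2 ⟹ κ_K = 1` (Washington Thm. 10.3: `C_{K⁺} → C_K` is injective when `Q_K = 2`), as a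
cardinality. [cite: Washington1997, Thm. 10.3] -/
theorem IsCMField.card_ker_classGroupExtend_eq_one_of_indexRealUnits_eq_two (hQ : indexRealUnits K = 2) :
    Nat.card (classGroupExtend (maximalRealSubfield K) K).ker = 1 := by
  rw [(MonoidHom.ker_eq_bot_iff _).mpr (classGroupExtend_injective_of_indexRealUnits_eq_two K hQ),
    Subgroup.card_bot]

/-- **The dichotomy for `K/K⁺` unramified at the finite primes (`√−1 ∉ K`): `(κ_K, Q_K) = (2, 1)` or
`(1, 2)`** — either a (unique non-trivial) ideal class of `K⁺` capitulates in `K` and `E_K = W_K E_{K⁺}`,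
or `C_{K⁺} → C_K` is injective and `Q_K = 2` (`K = K⁺(√−η)`, `η` a unit: unit radical form).
[cite: Okazaki2000, §3 Lemma 14] [cite: Washington1997, Thm. 10.3] -/
theorem IsCMField.card_ker_eq_two_or_indexRealUnits_eq_two_of_forall_isUnramifiedIn
    (hi : ∀ x : K, x ^ 2 ≠ -1)
    (hunr : ∀ v : HeightOneSpectrum (𝓞 (maximalRealSubfield K)), Algebra.IsUnramifiedIn (𝓞 K) v.asIdeal) :
    (Nat.card (classGroupExtend (maximalRealSubfield K) K).ker = 2 ∧ indexRealUnits K = 1) ∨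
      (Nat.card (classGroupExtend (maximalRealSubfield K) K).ker = 1 ∧ indexRealUnits K = 2) := by
  have h := IsCMField.card_ker_mul_indexRealUnits_eq_two_of_forall_isUnramifiedIn K hi hunr
  rcases card_ker_classGroupExtend_eq_one_or_two K with h1 | h2
  · rw [h1, one_mul] at h
    exact Or.inr ⟨h1, h⟩
  · rw [h2] at h
    exact Or.inl ⟨h2, by omega⟩

/-- **Contrapositive: if `κ_K Q_K = 1` and `−1` is not a square in `K`, then `K/K⁺` ramifies at some
finite prime of `K⁺`.** [cite: Okazaki2000, §3 Lemma 14] -/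
theorem IsCMField.exists_not_isUnramifiedIn_of_card_ker_mul_indexRealUnits_eq_one
    (hi : ∀ x : K, x ^ 2 ≠ -1)
    (h : Nat.card (classGroupExtend (maximalRealSubfield K) K).ker * indexRealUnits K = 1) :
    ∃ v : HeightOneSpectrum (𝓞 (maximalRealSubfield K)), ¬ Algebra.IsUnramifiedIn (𝓞 K) v.asIdeal := by
  by_contra hne
  push Not at hne
  have h2 := IsCMField.card_ker_mul_indexRealUnits_eq_two_of_forall_isUnramifiedIn K hi hne
  omega

/-- The same with `e(v, K/K⁺) ≠ 1`. [cite: Okazaki2000, §3 Lemma 14] -/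
theorem IsCMField.exists_ramificationIdxIn_ne_one_of_card_ker_mul_indexRealUnits_eq_one
    (hi : ∀ x : K, x ^ 2 ≠ -1)
    (h : Nat.card (classGroupExtend (maximalRealSubfield K) K).ker * indexRealUnits K = 1) :
    ∃ v : HeightOneSpectrum (𝓞 (maximalRealSubfield K)), v.asIdeal.ramificationIdxIn (𝓞 K) ≠ 1 := by
  by_contra hne
  push Not at hne
  have h2 := IsCMField.card_ker_mul_indexRealUnits_eq_two_of_forall_ramificationIdxIn_eq_one K hi hne
  omega

/-! ### §2. `κ_K Q_K = 2` ⟹ unramified at the odd primes -/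

/-- **Okazaki's Lemma 14, assembled: if `κ_K Q_K = 2` then `K/K⁺` is unramified at every finite prime `v`
of `K⁺` with `2 ∉ v`** — `K` is non-primary (`IsCMField.exists_sq_eq_neg_of_card_ker_mul_indexRealUnits_eq_two`)
and a non-primary `K/K⁺` is unramified at the odd primes
(`IsCMField.isUnramifiedIn_of_nonPrimary_of_two_notMem`).  No hypothesis on `√−1`.
[cite: Okazaki2000, §3 Lemma 14] -/
theorem IsCMField.isUnramifiedIn_of_card_ker_mul_indexRealUnits_eq_two
    (h : Nat.card (classGroupExtend (maximalRealSubfield K) K).ker * indexRealUnits K = 2)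
    (v : HeightOneSpectrum (𝓞 (maximalRealSubfield K))) (hv : (2 : 𝓞 (maximalRealSubfield K)) ∉ v.asIdeal) :
    Algebra.IsUnramifiedIn (𝓞 K) v.asIdeal := by
  obtain ⟨α, δ, 𝔞, hα0, hconj, hδ, h𝔞⟩ := IsCMField.exists_sq_eq_neg_of_card_ker_mul_indexRealUnits_eq_two K h
  exact IsCMField.isUnramifiedIn_of_nonPrimary_of_two_notMem K hα0 hconj hδ h𝔞 v hv

/-- **`Q_K = 2 ⟹ K/K⁺` is unramified at every finite prime `v ∤ 2`** (`Q_K = 2 ⟹ κ_K = 1`, so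
`κ_K Q_K = 2`; equivalently: `K = K⁺(√−η)` with `η` a unit is non-primary). [cite: Okazaki2000, §3 Lemma 14]
[cite: Washington1997, Thm. 10.3] -/
theorem IsCMField.isUnramifiedIn_of_indexRealUnits_eq_two (hQ : indexRealUnits K = 2)
    (v : HeightOneSpectrum (𝓞 (maximalRealSubfield K))) (hv : (2 : 𝓞 (maximalRealSubfield K)) ∉ v.asIdeal) :
    Algebra.IsUnramifiedIn (𝓞 K) v.asIdeal :=
  IsCMField.isUnramifiedIn_of_card_ker_mul_indexRealUnits_eq_two K
    (by rw [IsCMField.card_ker_classGroupExtend_eq_one_of_indexRealUnits_eq_two K hQ, hQ]) v hv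

/-- **`κ_K = 2 ⟹ K/K⁺` is unramified at every finite prime `v ∤ 2`** (`κ_K = 2` forces `Q_K = 1`, as
`Q_K = 2` would make `C_{K⁺} → C_K` injective; so `κ_K Q_K = 2`). [cite: Okazaki2000, §3 Lemma 14]
[cite: Washington1997, Thm. 10.3] -/
theorem IsCMField.isUnramifiedIn_of_card_ker_classGroupExtend_eq_two
    (hκ : Nat.card (classGroupExtend (maximalRealSubfield K) K).ker = 2)
    (v : HeightOneSpectrum (𝓞 (maximalRealSubfield K))) (hv : (2 : 𝓞 (maximalRealSubfield K)) ∉ v.asIdeal) :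
    Algebra.IsUnramifiedIn (𝓞 K) v.asIdeal := by
  rcases indexRealUnits_eq_one_or_two K with hQ | hQ
  · exact IsCMField.isUnramifiedIn_of_card_ker_mul_indexRealUnits_eq_two K (by rw [hκ, hQ]) v hv
  · have h1 := IsCMField.card_ker_classGroupExtend_eq_one_of_indexRealUnits_eq_two K hQ
    omega

/-- **If `K/K⁺` ramifies at some finite prime `v ∤ 2` of `K⁺`, then `κ_K Q_K = 1`** (contrapositive of
§2, using `κ_K, Q_K ∈ {1, 2}` and `Q_K = 2 ⟹ κ_K = 1`). [cite: Okazaki2000, §3 Lemma 14]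
[cite: Washington1997, Thm. 10.3] -/
theorem IsCMField.card_ker_mul_indexRealUnits_eq_one_of_not_isUnramifiedIn
    {v : HeightOneSpectrum (𝓞 (maximalRealSubfield K))} (hv : (2 : 𝓞 (maximalRealSubfield K)) ∉ v.asIdeal)
    (hram : ¬ Algebra.IsUnramifiedIn (𝓞 K) v.asIdeal) :
    Nat.card (classGroupExtend (maximalRealSubfield K) K).ker * indexRealUnits K = 1 := by
  rcases indexRealUnits_eq_one_or_two K with hQ | hQ
  · rcases card_ker_classGroupExtend_eq_one_or_two K with hκ | hκ
    · rw [hκ, hQ]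
    · exact absurd (IsCMField.isUnramifiedIn_of_card_ker_classGroupExtend_eq_two K hκ v hv) hram
  · exact absurd (IsCMField.isUnramifiedIn_of_indexRealUnits_eq_two K hQ v hv) hram

/-- **If `K/K⁺` ramifies at some finite prime `v ∤ 2`, then no ideal class of `K⁺` capitulates in `K`:
`C_{K⁺} → C_K` is injective** (`κ_K = 1`). [cite: Okazaki2000, §3 Lemma 14] [cite: Washington1997, Thm. 10.3] -/
theorem IsCMField.classGroupExtend_injective_of_not_isUnramifiedIn
    {v : HeightOneSpectrum (𝓞 (maximalRealSubfield K))} (hv : (2 : 𝓞 (maximalRealSubfield K)) ∉ v.asIdeal)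
    (hram : ¬ Algebra.IsUnramifiedIn (𝓞 K) v.asIdeal) :
    Function.Injective (classGroupExtend (maximalRealSubfield K) K) := by
  have h := IsCMField.card_ker_mul_indexRealUnits_eq_one_of_not_isUnramifiedIn K hv hram
  have h1 : Nat.card (classGroupExtend (maximalRealSubfield K) K).ker = 1 := Nat.eq_one_of_mul_eq_one_right h
  rw [← MonoidHom.ker_eq_bot_iff, ← Subgroup.card_eq_one, h1]

/-- **If `K/K⁺` ramifies at some finite prime `v ∤ 2`, then Hasse's unit index is `Q_K = 1`**:
`E_K = W_K E_{K⁺}`. [cite: Okazaki2000, §3 Lemma 14] [cite: Washington1997, Thm. 4.12] -/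
theorem IsCMField.indexRealUnits_eq_one_of_not_isUnramifiedIn
    {v : HeightOneSpectrum (𝓞 (maximalRealSubfield K))} (hv : (2 : 𝓞 (maximalRealSubfield K)) ∉ v.asIdeal)
    (hram : ¬ Algebra.IsUnramifiedIn (𝓞 K) v.asIdeal) : indexRealUnits K = 1 :=
  Nat.eq_one_of_mul_eq_one_left (IsCMField.card_ker_mul_indexRealUnits_eq_one_of_not_isUnramifiedIn K hv hram)

end Literature.NumberTheory.NumberFields

end
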